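import Summits.PneNP.PneNP.Theorems.ChebyshevTracialDesignTightLayerSums
import Literature.Barriers.PneNP.TSPExtensionComplexityRothvossAssembly
import HarnessLib

/-!
# Cell pnp-psdrank, route `ChebyshevTracialDesign`: the tight column sums of a harmonic layer, in the route's
# vocabulary (`PMatch n`, `OddSet n`, `cc`)

Harmonic backbone, brick 5b: the bridge from the involution files (`…MatchingHarmonics`, `…InvolutionKeys`,
`…MatchingClosedSums`, `…TightLayerSums`, where a perfect matching is its fixed-point-free partner map `π`) to the tree's
perfect matchings `M : PMatch n` of Rothvoß's slack matrix [cite: Rothvoss2017, §2 (PDF pp. 5–6)]: `π = IsPMOn.partner`,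
`cc U M = #{x ∈ U : partner x ∉ U}` (`cc_eq_card_filter_partner`: crossing edges ↔ their endpoint in `U`), and the
re-indexing of the `t`-cuts of `OddSet n` by `t`-subsets. MAIN STATEMENTS, for a Johnson-harmonic coefficient vector `p`
of degree `k` (lit's `JohnsonHarmonics`) and its layer function `U ↦ zeta p (U)` on the `t`-cuts (`t` odd):
* `tight_column_sum_eq_zero_of_odd` : `Σ_{|U| = t, cc(U,M) = 1} zeta p (U) = 0` for every perfect matching `M` when `k`
  is ODD — the tight incidence `A_1(U,M) = 1[cc(U,M) = 1]` kills the odd Johnson layers of the cut side;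
* `tight_column_sum_eq_of_even` : for `k = 2κ` (`4κ ≤ n`, `2κ < t`),
  `Σ_{|U| = t, cc(U,M) = 1} zeta p (U) = (n − t + 1 − 2κ) · C(n/2 − 2κ, (t−1)/2 − κ) · Σ_{T M-closed, |T| = 2κ} p_T`
  — MEMO-7 (★) at the tight level: `A_1ᵀ` maps the whole even layer onto the single matching-side functional
  `M ↦ Π_p(M) = Σ_{F ⊆ M, |F| = κ} p_{V(F)}` [cite: GodsilMeagher2015, §15.2 (perfect matching scheme)].
WHAT THIS IS NOT: the eigenvalues (★★) of the tight Gram kernel need one more count (the dipole test vector), then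
lit's `JohnsonSpectrum` §7 zero-rectangle bound gives the σ₂ brick; nothing on psd rank. Supports crux stmt-PneNP-19878.
-/

set_option linter.dupNamespace false -- `Summit.PneNP.PneNP.…`: summit = sub-problem (D-0017)

noncomputable section

namespace Summit.PneNP.PneNP.Theorems.ChebyshevTracialDesignTightColumnSums

open Finset Literature.Combinatorics.AssociationSchemes Literature.Combinatorics.AssociationSchemes.JohnsonHarmonics
open Literature.Barriers.PneNP Literature.Combinatorics.SimpleGraph.CycleSpace
open Summit.PneNP.PneNP.Theorems.ChebyshevTracialDesignTightLayerSums
open Summit.PneNP.PneNP.Theorems.ChebyshevTracialDesignInvolutionKeys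

variable {n : ℕ}

/-! ### §1 Crossing edges are counted by their endpoint inside the cut -/

/-- **`cc U M = #{x ∈ U : partner x ∉ U}`**: the edges of `M` crossing `U` correspond to their endpoint in `U`. -/
theorem cc_eq_card_filter_partner (U : OddSet n) (M : PMatch n) :
    cc U M = (U.1.filter fun x => M.2.partner x ∉ U.1).card := by
  classical
  unfold cc
  symm
  refine card_bij (fun x _ => s(x, M.2.partner x)) ?_ ?_ ?_
  · intro x hx
    rw [mem_filter] at hx ⊢
    exact ⟨M.2.mk_partner_mem x, (crosses_mk U.1 _ _).2 (Or.inl ⟨hx.1, hx.2⟩)⟩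
  · intro x hx y hy hxy
    rw [mem_filter] at hx hy
    rcases Sym2.eq_iff.1 hxy with ⟨h, -⟩ | ⟨h1, h2⟩
    · exact h
    · -- `x = partner y` and `partner x = y`: then `y = partner x ∉ U`, contradicting `y ∈ U`
      exact absurd hy.1 (h2 ▸ hx.2)
  · intro e he
    rw [mem_filter] at he
    obtain ⟨a, b, rfl, ha, hb⟩ := crosses_iff_exists.1 he.2
    refine ⟨a, mem_filter.2 ⟨ha, ?_⟩, ?_⟩
    · rw [← M.2.eq_partner_of_mem he.1]; exact hb
    · rw [← M.2.eq_partner_of_mem he.1]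

/-- The partner map of a perfect matching is a fixed-point-free involution. -/
theorem partner_invol (M : PMatch n) : (∀ x, M.2.partner (M.2.partner x) = x) ∧ ∀ x, M.2.partner x ≠ x :=
  ⟨M.2.partner_partner, M.2.partner_ne⟩

/-- Re-indexing the `t`-cuts (`t` odd) of `OddSet n` by the `t`-subsets of `Fin n`. -/
theorem sum_oddSet_eq_sum_powersetCard {t : ℕ} (ht : Odd t) (P : Finset (Fin n) → Prop) [DecidablePred P]
    (F : Finset (Fin n) → ℝ) :
    ∑ U ∈ univ.filter (fun U : OddSet n => U.1.card = t ∧ P U.1), F U.1 =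
      ∑ U ∈ (powersetCard t (univ : Finset (Fin n))).filter P, F U := by
  refine sum_bij (fun U _ => U.1) ?_ ?_ ?_ ?_
  · intro U hU
    simp only [mem_filter, mem_univ, true_and, mem_powersetCard, subset_univ] at hU ⊢
    exact hU
  · intro U _ U' _ h
    exact Subtype.ext h
  · intro U hU
    simp only [mem_filter, mem_powersetCard, subset_univ, true_and] at hU
    have hodd : Odd U.card := hU.1 ▸ ht
    refine ⟨⟨U, hodd⟩, ?_, rfl⟩
    simp only [mem_filter, mem_univ, true_and]
    exact hU
  · intro U _; rfl

/-! ### §2 The tight column sums of a harmonic layer -/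

/-- The tight `t`-cuts of `M`, re-indexed by `t`-subsets with the partner predicate. -/
theorem sum_tight_oddSet_eq (M : PMatch n) {t : ℕ} (ht : Odd t) (F : Finset (Fin n) → ℝ) :
    ∑ U ∈ univ.filter (fun U : OddSet n => U.1.card = t ∧ cc U M = 1), F U.1 =
      ∑ U ∈ (powersetCard t (univ : Finset (Fin n))).filter
        (fun U => (U.filter fun x => M.2.partner x ∉ U).card = 1), F U := by
  classical
  have hfilter : univ.filter (fun U : OddSet n => U.1.card = t ∧ cc U M = 1) =
      univ.filter (fun U : OddSet n => U.1.card = t ∧ (U.1.filter fun x => M.2.partner x ∉ U.1).card = 1) :=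
    filter_congr fun U _ => by rw [cc_eq_card_filter_partner]
  rw [hfilter]
  exact sum_oddSet_eq_sum_powersetCard ht (fun U => (U.filter fun x => M.2.partner x ∉ U).card = 1) F

/-- **Odd Johnson layers are invisible to the tight incidence.** For every perfect matching `M` of `K_n`, every odd
`t`, and every Johnson-harmonic `p` of ODD degree `k`: `Σ_{|U| = t, cc(U,M) = 1} zeta p (U) = 0`. -/
theorem tight_column_sum_eq_zero_of_odd (M : PMatch n) {t : ℕ} (ht : Odd t) {k : ℕ} (hk : Odd k)
    {p : Finset (Fin n) → ℝ} (hp : IsHarmonic k p) :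
    ∑ U ∈ univ.filter (fun U : OddSet n => U.1.card = t ∧ cc U M = 1), zeta p U.1 = 0 := by
  rw [sum_tight_oddSet_eq M ht]
  obtain ⟨a, rfl⟩ := ht
  exact tightSum_zeta_eq_zero_of_odd (partner_invol M).1 (partner_invol M).2 hk hp a

/-- **Tight column sums in even degree** (MEMO-7 (★) at the tight level). For every perfect matching `M` of `K_n`,
`t = 2a + 1`, and every Johnson-harmonic `p` of degree `2κ` with `4κ ≤ n` and `κ ≤ a`:
`Σ_{|U| = t, cc(U,M) = 1} zeta p (U) = (n − 2a − 2κ) · C(n/2 − 2κ, a − κ) · Σ_{T : #{x ∈ T : partner x ∈ T} = 2κ} p_T`,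
the last sum running over the `2κ`-sets made of `κ` edges of `M` (all other `T` in that class lie off the support of `p`). -/
theorem tight_column_sum_eq_of_even (M : PMatch n) {a κ : ℕ} (hκn : 4 * κ ≤ n) (hκa : κ ≤ a)
    {p : Finset (Fin n) → ℝ} (hp : IsHarmonic (2 * κ) p) :
    ∑ U ∈ univ.filter (fun U : OddSet n => U.1.card = 2 * a + 1 ∧ cc U M = 1), zeta p U.1 =
      ((n : ℝ) - (2 * a : ℕ) - (2 * κ : ℕ)) * ((((n / 2 - 2 * κ).choose (a - κ) : ℕ) : ℝ) *
        ∑ T ∈ univ.filter (fun T : Finset (Fin n) => (T.filter fun x => M.2.partner x ∈ T).card = 2 * κ), p T) := by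
  rw [sum_tight_oddSet_eq M ⟨a, rfl⟩,
    tightSum_zeta_eq_of_even (partner_invol M).1 (partner_invol M).2 hκn hp hκa]
  have hkeys : ((univ : Finset (Fin n)).filter fun x => x < M.2.partner x).card = n / 2 := by
    have := two_mul_card_keys (partner_invol M).1 (partner_invol M).2
    omega
  rw [hkeys]

end Summit.PneNP.PneNP.Theorems.ChebyshevTracialDesignTightColumnSums
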